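import Literature.Analysis.Complex.LaguerrePolyaClass
import Literature.Barriers.RiemannHypothesis.JensenPolynomialsKimProofs
import HarnessLib

/-!
# The Pólya–Wiman theorem for real entire functions of order `< 2` (Ki–Kim 2000, Thm. 2.1), proved

Topic `Literature/Analysis/Complex` (trunk T-CA); theorem-only companion of `LaguerrePolyaClass.lean`
(definitions `IsLaguerrePolya`, `IsLaguerrePolyaStar`, `nonrealZeroCount`). Everything here is
PROVED; no definitions, no named facts.

**The Pólya–Wiman theorem** (conjectured by Pólya 1930 and Wiman; proved by Craven–Csordas–Smith,
Ann. of Math. 125 (1987) in genus `≤ 1` and by Kim, PAMS 109 (1990) in general; Ki–Kim, Duke Math. J.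
104 (2000), §2, Thm. 2.1 p. 52: "For each real entire function `f(z)` in the class `𝔏`, there is a
positive integer `n` such that the functions `f^{(n)}(z), f^{(n+1)}(z), …` have only real zeros";
Craven–Csordas 2006, Thm. 3.24). Here, for the functions the tree works with — **real entire of
order `< 2`** (`IsEntireOfOrderLt 2`) **with finitely many non-real zeros** (the order-`< 2` part of
`𝔏 = 𝓛𝓟*`, cf. `LaguerrePolyaStarOrderLtTwo.lean`):

* `Literature.Analysis.Complex.polyaWiman_of_isEntireOfOrderLt_two` — `∃ N, ∀ n ≥ N,
  F^{(n)} ∈ 𝓛𝓟` (`IsLaguerrePolya (iteratedDeriv n F)`);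
* `Literature.Analysis.Complex.polyaWiman_hasOnlyRealZeros` — the printed conclusion: for `n ≥ N`
  every zero of `F^{(n)}` is real (when no derivative of `F` vanishes identically; in this file's
  encoding the vanishing derivatives of a polynomial are the degenerate member `0 ∈ 𝓛𝓟`);
* `Literature.Analysis.Complex.polyaWiman_nonrealZeroCount_eq_zero` — `Z_c(F^{(n)}) = 0` for
  `n ≥ N`.

## Proof (Ki–Kim 2000, §2, specialised to growth `(2, 0)`)

The tree already discharges Kim's LOCAL theorem (`Farmer2022_kimTheorem_holds` in
`Literature/Barriers/RiemannHypothesis/JensenPolynomialsKimProofs.lean`: for each `R`, eventually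
`f^{(n)}` has only real zeros in `|z| < R`) by Ki–Kim's method: backward Jensen chains
(`exists_jensen_chain`), their variation `≤ Im z₀ (1 + √n)` (`chain_variation_le`, Ki–Kim (2.5)),
Gontcharoff's estimate (`gontcharoff_norm_le`, Ki–Kim (2.3)) and Cauchy's estimate with radius
`e² L` (`norm_iteratedDeriv_le_of_growth`, Ki–Kim Lemma 2.1). The global statement needs one
change of bookkeeping, which is exactly where the hypothesis "finitely many non-real zeros" of the
class `𝔏` enters Ki–Kim's proof (p. 52, "each `Xₙ` is finite"): the chain `z₀, …, zₙ = w` descending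
from a non-real zero `w` of `F^{(n)}` ends at a non-real zero `z₀` of `F` itself, and these lie in
a FIXED disc `|z| < R`; so all points of the chain lie in `|z| ≤ R + Im z₀ (1 + √n)` wherever `w`
is (`norm_le_exp_neg_of_nonreal_zero_anchored`, the bottom-anchored form of the tree's
`norm_le_exp_neg_of_nonreal_zero`). Growth `e^{(a + b√n)^ρ}` with `ρ < 2` against the factor
`e^{−2n}` then gives `‖F(u)‖ ≤ C' e^{−n}` for every `n` for which `F^{(n)}` has a non-real zero; if
that happened for infinitely many `n`, `F ≡ 0`. For the remaining `n` the derivative `F^{(n)}` is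
real entire of order `< 2` (`exists_growth_iteratedDeriv`) with only real zeros, hence in `𝓛𝓟` by
the order-`< 2` Laguerre–Pólya theorem (`isLaguerrePolya_of_isEntireOfOrderLt_two`, de Bruijn's
Thm. 6). (If some derivative vanishes identically, `F` is a polynomial and the later derivatives are
the zero function, a member of the class as encoded.)

## References

* H. Ki, Y.-O. Kim, *On the number of nonreal zeros of real entire functions and the Fourier–Pólya
  conjecture*, Duke Math. J. 104 (2000) 45–73, §2: Lemma 2.1, (2.3), (2.5), Thm. 2.1 [KiKim2000].
* Y.-O. Kim, *A proof of the Pólya–Wiman conjecture*, Proc. AMS 109 (1990) 1045–1052, Thm. 1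
  [Kim1990].
* T. Craven, G. Csordas, W. Smith, Ann. of Math. 125 (1987) 405–431 [CravenCsordasSmith1987].
* T. Craven, G. Csordas, *Composition theorems, multiplier sequences and complex zero decreasing
  sequences* (2006), Thm. 3.24 [CravenCsordas2006].
-/

noncomputable section

open Complex Filter Metric Set Topology Polynomial
open scoped ComplexConjugate

namespace Literature.Analysis.Complex

open Literature.Barriers.RiemannHypothesis (exists_jensen_chain chain_variation_le
  norm_iteratedDeriv_le_of_growth exists_rpow_le_eps_mul_sq_add)

section PolyaWiman

variable {f : ℂ → ℂ}

/-- **The key estimate, anchored at the bottom of the Jensen chain** (variant of the tree's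
`Literature.Barriers.RiemannHypothesis.norm_le_exp_neg_of_nonreal_zero`, where the TOP zero `w`
is confined to `|w| < R`). Let `f` be real entire with `‖f‖ ≤ C e^{‖z‖^ρ}` (`0 ≤ ρ < 2`), no
derivative vanishing identically, all zeros of all derivatives in `|Im z| ≤ Δ`, and all NON-REAL
zeros of `f` itself in `|z| < R`. Fix `u`. Then there is `K` such that for every `n ≥ 1` for which
`f^{(n)}` has a zero `w` with `Im w > 0` (anywhere), `‖f(u)‖ ≤ C e^{K} e^{−n}`: the backward Jensen
chain from `w` ends at a non-real zero `z₀` of `f`, `|z₀| < R`, and has variation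
`≤ Δ (1 + √n)`; Gontcharoff on the disc `|z| ≤ |u| + L`, `L = |u| + R + 2Δ + 2Δ√n`, and Cauchy
with radius `e² L`. [cite: KiKim2000, §2 proof of Thm. 2.1 (Lemma 2.1, (2.3), (2.5))] -/
theorem norm_le_exp_neg_of_nonreal_zero_anchored (hf : Differentiable ℂ f) {ρ C : ℝ}
    (hρ0 : 0 ≤ ρ) (hρ : ρ < 2) (hgr : ∀ z, ‖f z‖ ≤ C * Real.exp (‖z‖ ^ ρ))
    (hreal : ∀ x : ℝ, (f x).im = 0) (hnz : ∀ n : ℕ, iteratedDeriv n f ≠ 0) {Δ : ℝ} (hΔ : 0 ≤ Δ)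
    (hstrip : ∀ (k : ℕ) (z : ℂ), iteratedDeriv k f z = 0 → |z.im| ≤ Δ) {R : ℝ} (hR : 0 < R)
    (hanchor : ∀ z : ℂ, f z = 0 → z.im ≠ 0 → ‖z‖ < R) (u : ℂ) :
    ∃ K : ℝ, ∀ n : ℕ, 1 ≤ n → (∃ w : ℂ, iteratedDeriv n f w = 0 ∧ 0 < w.im) →
      ‖f u‖ ≤ C * Real.exp K * Real.exp (-(n : ℝ)) := by
  have hC : 0 ≤ C := growthConst_nonneg hgr
  -- constants
  set A : ℝ := ‖u‖ + R + 2 * Δ with hA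
  set B : ℝ := 2 * Δ with hB
  have hApos : 0 < A := by positivity
  have hB0 : 0 ≤ B := by positivity
  set a : ℝ := ‖u‖ + (1 + Real.exp 2) * A with ha
  set b : ℝ := (1 + Real.exp 2) * B with hb
  have ha0 : 0 ≤ a := by positivity
  have hb0 : 0 ≤ b := by positivity
  obtain ⟨K, hK0, hK⟩ :=
    exists_rpow_le_eps_mul_sq_add hρ0 hρ (ε := 1 / (2 * b ^ 2 + 2)) (by positivity)
  refine ⟨K + a ^ 2, fun n hn ⟨w, hw0, hwim⟩ ↦ ?_⟩
  obtain ⟨z, hzn, hzero, hpos, hrel⟩ := exists_jensen_chain hf hρ0 hρ hgr hreal hnz n hwim hw0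
  -- the bottom of the chain is a non-real zero of `f`, inside `|z| < R`
  have hz0R : ‖z 0‖ < R := by
    refine hanchor (z 0) ?_ (hpos 0 (Nat.zero_le _)).ne'
    have := hzero 0 (Nat.zero_le _)
    simpa using this
  -- the variation of the chain
  set V : ℝ := ∑ k ∈ Finset.range n, ‖z k - z (k + 1)‖ with hV
  have hV0 : 0 ≤ V := Finset.sum_nonneg fun k _ ↦ norm_nonneg _
  have hz0im : (z 0).im ≤ Δ :=
    (le_abs_self _).trans (hstrip 0 (z 0) (hzero 0 (Nat.zero_le _)))
  have hVle : V ≤ Δ * (1 + Real.sqrt n) :=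
    (chain_variation_le hpos hrel).trans (mul_le_mul_of_nonneg_right hz0im (by positivity))
  set L : ℝ := A + B * Real.sqrt n with hL
  have hLpos : 0 < L := by positivity
  have hVL : R + 2 * V ≤ L - ‖u‖ := by
    rw [hL, hA, hB]; nlinarith [Real.sqrt_nonneg (n : ℝ)]
  -- all points of the chain are within `V` of the bottom `z 0`
  have hzk : ∀ k ≤ n, ‖z 0 - z k‖ ≤ V := by
    intro k hk
    have h := dist_le_Ico_sum_dist z (Nat.zero_le k)
    rw [dist_eq_norm] at h
    refine h.trans ?_
    simp only [dist_eq_norm]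
    refine Finset.sum_le_sum_of_subset_of_nonneg ?_ fun i _ _ ↦ norm_nonneg _
    rw [Finset.range_eq_Ico]
    exact Finset.Ico_subset_Ico_right hk
  have hznorm : ∀ k ≤ n, ‖z k‖ ≤ R + V := by
    intro k hk
    calc ‖z k‖ = ‖z 0 - (z 0 - z k)‖ := by rw [sub_sub_cancel]
      _ ≤ ‖z 0‖ + ‖z 0 - z k‖ := norm_sub_le _ _
      _ ≤ R + V := add_le_add hz0R.le (hzk k hk)
  -- the convex set and memberships
  set Kset : Set ℂ := closedBall (0 : ℂ) (‖u‖ + L) with hKset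
  have hKconv : Convex ℝ Kset := convex_closedBall _ _
  have hmemz : ∀ k ≤ n, z k ∈ Kset := fun k hk ↦ by
    rw [hKset, mem_closedBall_zero_iff]
    have := hznorm k hk
    linarith [norm_nonneg u]
  have hmemu : u ∈ Kset := by
    rw [hKset, mem_closedBall_zero_iff]; linarith
  -- write `n = j + 1`
  obtain ⟨j, rfl⟩ : ∃ j, n = j + 1 := ⟨n - 1, by omega⟩
  -- Cauchy's estimate on `Kset` with radius `s = e² L`
  set s : ℝ := Real.exp 2 * L with hs
  have hspos : 0 < s := by positivity
  have hM : ∀ v ∈ Kset, ‖iteratedDeriv (j + 1) f v‖ ≤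
      (j + 1).factorial * (C * Real.exp ((‖u‖ + L + s) ^ ρ)) / s ^ (j + 1) := fun v hv ↦
    norm_iteratedDeriv_le_of_growth hf hρ0 hgr (j + 1) hspos
      (by rw [hKset, mem_closedBall_zero_iff] at hv; exact hv)
  -- Gontcharoff
  have hG := gontcharoff_norm_le hKconv j hf z (fun k hk ↦ hmemz k (by omega))
    (fun k hk ↦ hzero k (by omega)) hM hmemu
  -- the variation entering Gontcharoff's estimate is at most `L`
  have hvar : ‖u - z 0‖ + ∑ k ∈ Finset.range j, ‖z k - z (k + 1)‖ ≤ L := by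
    have h1 : ∑ k ∈ Finset.range j, ‖z k - z (k + 1)‖ ≤ V := by
      rw [hV]
      exact Finset.sum_le_sum_of_subset_of_nonneg (Finset.range_subset_range.2 (Nat.le_succ j))
        fun i _ _ ↦ norm_nonneg _
    have h2 : ‖u - z 0‖ ≤ ‖u‖ + (R + V) :=
      (norm_sub_le _ _).trans (add_le_add le_rfl (hznorm 0 (Nat.zero_le _)))
    linarith
  have hvar0 : 0 ≤ ‖u - z 0‖ + ∑ k ∈ Finset.range j, ‖z k - z (k + 1)‖ := by positivity
  -- combine: `‖f u‖ ≤ C e^{(‖u‖ + L + s)^ρ} (L/s)^{j+1}`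
  have hLne : L ≠ 0 := hLpos.ne'
  have hsne : s ≠ 0 := hspos.ne'
  have he2 : Real.exp 2 ≠ 0 := (Real.exp_pos 2).ne'
  have hLs : L / s = Real.exp (-2) := by
    rw [hs, Real.exp_neg]; field_simp
  have hstep1 : ‖f u‖ ≤ C * Real.exp ((‖u‖ + L + s) ^ ρ) * Real.exp (-2) ^ (j + 1) := by
    calc ‖f u‖ ≤ (j + 1).factorial * (C * Real.exp ((‖u‖ + L + s) ^ ρ)) / s ^ (j + 1) *
          (‖u - z 0‖ + ∑ k ∈ Finset.range j, ‖z k - z (k + 1)‖) ^ (j + 1) /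
            (j + 1).factorial := hG
      _ ≤ (j + 1).factorial * (C * Real.exp ((‖u‖ + L + s) ^ ρ)) / s ^ (j + 1) *
          L ^ (j + 1) / (j + 1).factorial := by
          gcongr
      _ = C * Real.exp ((‖u‖ + L + s) ^ ρ) * (L / s) ^ (j + 1) := by
          have hfact : ((j + 1).factorial : ℝ) ≠ 0 := by positivity
          rw [div_pow]
          field_simp
      _ = C * Real.exp ((‖u‖ + L + s) ^ ρ) * Real.exp (-2) ^ (j + 1) := by rw [hLs]
  -- the exponent: `(‖u‖ + L + s)^ρ ≤ (j+1) + a² + K`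
  have hE : ‖u‖ + L + s = a + b * Real.sqrt (j + 1 : ℕ) := by
    rw [hs, hL, ha, hb]; ring
  have hexp : (‖u‖ + L + s) ^ ρ ≤ ((j + 1 : ℕ) : ℝ) + a ^ 2 + K := by
    rw [hE]
    set N : ℝ := ((j + 1 : ℕ) : ℝ) with hN
    set q : ℝ := Real.sqrt N with hq
    have hN0 : 0 ≤ N := Nat.cast_nonneg _
    have hq0 : 0 ≤ q := Real.sqrt_nonneg _
    have hx : 0 ≤ a + b * q := by positivity
    refine (hK _ hx).trans ?_
    have hsq : (a + b * q) ^ 2 ≤ 2 * a ^ 2 + 2 * b ^ 2 * N := by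
      have e : q ^ 2 = N := Real.sq_sqrt hN0
      have h3 : (a + b * q) ^ 2 = 2 * a ^ 2 + 2 * b ^ 2 * q ^ 2 - (a - b * q) ^ 2 := by ring
      rw [h3, e]
      linarith [sq_nonneg (a - b * q)]
    have hden : 0 < 2 * b ^ 2 + 2 := by positivity
    have h1 : 1 / (2 * b ^ 2 + 2) * (a + b * q) ^ 2 ≤ N + a ^ 2 := by
      calc 1 / (2 * b ^ 2 + 2) * (a + b * q) ^ 2
          ≤ 1 / (2 * b ^ 2 + 2) * (2 * a ^ 2 + 2 * b ^ 2 * N) :=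
            mul_le_mul_of_nonneg_left hsq (by positivity)
        _ ≤ N + a ^ 2 := by
            rw [div_mul_eq_mul_div, one_mul, div_le_iff₀ hden]
            have h4 : (N + a ^ 2) * (2 * b ^ 2 + 2) =
                2 * a ^ 2 + 2 * b ^ 2 * N + (2 * N + 2 * a ^ 2 * b ^ 2) := by ring
            rw [h4]
            have h5 : 0 ≤ 2 * N + 2 * a ^ 2 * b ^ 2 := by positivity
            linarith
    linarith
  -- conclude
  calc ‖f u‖ ≤ C * Real.exp ((‖u‖ + L + s) ^ ρ) * Real.exp (-2) ^ (j + 1) := hstep1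
    _ ≤ C * Real.exp (((j + 1 : ℕ) : ℝ) + a ^ 2 + K) * Real.exp (-2) ^ (j + 1) := by
        gcongr
    _ = C * Real.exp (K + a ^ 2) * Real.exp (-((j + 1 : ℕ) : ℝ)) := by
        have key : Real.exp (((j + 1 : ℕ) : ℝ) + a ^ 2 + K) * Real.exp (-2) ^ (j + 1) =
            Real.exp (K + a ^ 2) * Real.exp (-((j + 1 : ℕ) : ℝ)) := by
          rw [← Real.exp_nat_mul, ← Real.exp_add, ← Real.exp_add]
          congr 1
          push_cast
          ring
        rw [mul_assoc, key, ← mul_assoc]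

/-- The iterated derivatives of the zero function vanish. [folklore] -/
private theorem iteratedDeriv_zero_fun (m : ℕ) : iteratedDeriv m (0 : ℂ → ℂ) = 0 := by
  induction m with
  | zero => simp
  | succ m ih =>
    rw [iteratedDeriv_succ, ih]
    funext x
    exact deriv_const x (0 : ℂ)

/-- Once a derivative vanishes identically, all later ones do. [folklore] -/
private theorem iteratedDeriv_eq_zero_of_le {k n : ℕ} (hk : iteratedDeriv k f = 0) (hkn : k ≤ n) :
    iteratedDeriv n f = 0 := by
  obtain ⟨m, rfl⟩ := Nat.exists_eq_add_of_le hkn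
  rw [iteratedDeriv_eq_iterate, add_comm, Function.iterate_add_apply, ← iteratedDeriv_eq_iterate,
    ← iteratedDeriv_eq_iterate, hk]
  exact iteratedDeriv_zero_fun m

/-- Every derivative of a real entire function of order `< 2` all of whose zeros are real is in
`𝓛𝓟` (growth of derivatives + the order-`< 2` Laguerre–Pólya theorem).
[cite: KiKim2000, §2 p. 49 (The Laguerre–Pólya theorem)] -/
theorem isLaguerrePolya_iteratedDeriv_of_zeros_real (hf : Differentiable ℂ f) {ρ C : ℝ}
    (hρ0 : 0 ≤ ρ) (hρ : ρ < 2) (hgr : ∀ z, ‖f z‖ ≤ C * Real.exp (‖z‖ ^ ρ))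
    (hreal : ∀ x : ℝ, (f x).im = 0) (n : ℕ)
    (hzero : ∀ z, iteratedDeriv n f z = 0 → z.im = 0) : IsLaguerrePolya (iteratedDeriv n f) := by
  obtain ⟨ρ', C', -, hρ', hgr'⟩ := exists_growth_iteratedDeriv hf hρ0 hρ hgr n
  exact isLaguerrePolya_of_growth (differentiable_iteratedDeriv_of_entire hf n) hρ' hgr'
    (im_iteratedDeriv_ofReal hf hreal n) hzero

/-- **The Pólya–Wiman theorem for real entire functions of order `< 2`** (Ki–Kim 2000, Thm. 2.1,
in the tree's vocabulary): if `F` is entire with `‖F z‖ ≤ C e^{‖z‖^ρ}` for some `ρ < 2`, real on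
the real axis, and has only finitely many non-real zeros, then from some order on all derivatives
`F^{(n)}` are in the Laguerre–Pólya class. (For `F` a polynomial the late derivatives are the zero
function, a degenerate member of the class as encoded in `LaguerrePolyaClass.lean`.)
[cite: KiKim2000, §2 Thm. 2.1] [cite: Kim1990, Thm. 1] [cite: CravenCsordas2006, Thm. 3.24] -/
theorem polyaWiman_of_isEntireOfOrderLt_two {F : ℂ → ℂ} (hF : IsEntireOfOrderLt 2 F)
    (hreal : IsRealOnReal F) (hfin : {z : ℂ | F z = 0 ∧ z.im ≠ 0}.Finite) :
    ∃ N : ℕ, ∀ n : ℕ, N ≤ n → IsLaguerrePolya (iteratedDeriv n F) := by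
  obtain ⟨hdiff, ρ₀, C₀, hρ₀, hgr₀⟩ := hF
  -- polynomial case: some derivative vanishes identically
  by_cases hnz : ∀ n : ℕ, iteratedDeriv n F ≠ 0
  swap
  · push Not at hnz
    obtain ⟨k, hk⟩ := hnz
    refine ⟨k, fun n hn ↦ ?_⟩
    rw [iteratedDeriv_eq_zero_of_le hk hn]
    exact isLaguerrePolya_zero
  -- transcendental case
  obtain ⟨ρ, C, hρ0, hρ, -, hgr⟩ := DeBruijn1950.growth_normalise_two hdiff hρ₀ hgr₀
  have hC : 0 ≤ C := growthConst_nonneg hgr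
  -- a disc containing the non-real zeros of `F`
  obtain ⟨R, hRpos, hR⟩ : ∃ R : ℝ, 0 < R ∧ ∀ z : ℂ, F z = 0 → z.im ≠ 0 → ‖z‖ < R := by
    obtain ⟨M, hM⟩ := (hfin.image fun z ↦ ‖z‖).bddAbove
    refine ⟨|M| + 1, by positivity, fun z hz hzi ↦ ?_⟩
    have : ‖z‖ ≤ M := hM (Set.mem_image_of_mem _ ⟨hz, hzi⟩)
    linarith [le_abs_self M]
  -- all zeros of `F`, hence of all derivatives, lie in the strip `|Im z| ≤ R`
  have hstrip : ∀ z, F z = 0 → |z.im| ≤ R := by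
    intro z hz
    by_cases hzi : z.im = 0
    · rw [hzi, abs_zero]; exact hRpos.le
    · exact (Complex.abs_im_le_norm z).trans (hR z hz hzi).le
  have hstripk : ∀ (k : ℕ) (z : ℂ), iteratedDeriv k F z = 0 → |z.im| ≤ R := fun k z hz ↦
    abs_im_le_of_iteratedDeriv_eq_zero hdiff hρ0 hρ hgr hreal hnz hRpos.le hstrip k hz
  -- suppose not: infinitely many derivatives have a non-real zero
  by_contra hcon
  push Not at hcon
  have hbad : ∀ N : ℕ, ∃ n, N ≤ n ∧ ∃ w : ℂ, iteratedDeriv n F w = 0 ∧ 0 < w.im := by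
    intro N
    obtain ⟨n, hn, hnot⟩ := hcon N
    -- `F^{(n)} ∉ 𝓛𝓟` forces a non-real zero, w.l.o.g. in the upper half-plane
    have hex : ∃ z : ℂ, iteratedDeriv n F z = 0 ∧ z.im ≠ 0 := by
      by_contra h
      push Not at h
      exact hnot (isLaguerrePolya_iteratedDeriv_of_zeros_real hdiff hρ0 hρ hgr hreal n h)
    obtain ⟨z, hz0, hzim⟩ := hex
    rcases lt_or_gt_of_ne hzim with hneg | hpos
    · refine ⟨n, hn, conj z, ?_, by simpa using hneg⟩
      rw [apply_conj_eq_conj (differentiable_iteratedDeriv_of_entire hdiff n)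
        (im_iteratedDeriv_ofReal hdiff hreal n), hz0, map_zero]
    · exact ⟨n, hn, z, hz0, hpos⟩
  -- hence `F ≡ 0`, contradicting `hnz 0`
  suffices hmain : ∀ u : ℂ, F u = 0 by
    exact hnz 0 (funext fun u ↦ by simpa using hmain u)
  intro u
  obtain ⟨K, hK⟩ := norm_le_exp_neg_of_nonreal_zero_anchored hdiff hρ0 hρ hgr hreal hnz hRpos.le
    hstripk hRpos hR u
  have hle : ∀ N : ℕ, ‖F u‖ ≤ C * Real.exp K * Real.exp (-(N : ℝ)) := by
    intro N
    obtain ⟨n, hn, hw⟩ := hbad (max N 1)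
    have h1 : 1 ≤ n := (le_max_right _ _).trans hn
    have hNn : (N : ℝ) ≤ n := by exact_mod_cast (le_max_left _ _).trans hn
    calc ‖F u‖ ≤ C * Real.exp K * Real.exp (-(n : ℝ)) := hK n h1 hw
      _ ≤ C * Real.exp K * Real.exp (-(N : ℝ)) := by gcongr
  have hlim : Tendsto (fun N : ℕ ↦ C * Real.exp K * Real.exp (-(N : ℝ))) atTop (𝓝 0) := by
    have h := (Real.tendsto_exp_neg_atTop_nhds_zero.comp tendsto_natCast_atTop_atTop).const_mul
      (C * Real.exp K)
    simpa using h
  have h0 : ‖F u‖ ≤ 0 := ge_of_tendsto' hlim hle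
  exact norm_le_zero_iff.1 h0

/-- **Pólya–Wiman, printed conclusion**: for a real entire function of order `< 2` with finitely
many non-real zeros, none of whose derivatives vanishes identically (i.e. not a polynomial), the
derivatives from a certain one onward have only real zeros. [cite: KiKim2000, §2 Thm. 2.1]
[cite: Kim1990, Thm. 1] -/
theorem polyaWiman_hasOnlyRealZeros {F : ℂ → ℂ} (hF : IsEntireOfOrderLt 2 F)
    (hreal : IsRealOnReal F) (hfin : {z : ℂ | F z = 0 ∧ z.im ≠ 0}.Finite)
    (hnz : ∀ n : ℕ, iteratedDeriv n F ≠ 0) :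
    ∃ N : ℕ, ∀ n : ℕ, N ≤ n → ∀ z : ℂ, iteratedDeriv n F z = 0 → z.im = 0 := by
  obtain ⟨N, hN⟩ := polyaWiman_of_isEntireOfOrderLt_two hF hreal hfin
  exact ⟨N, fun n hn z hz ↦ (hN n hn).im_eq_zero_of_eq_zero (Function.ne_iff.1 (hnz n)) hz⟩

/-- **Pólya–Wiman in terms of `Z_c`**: `Z_c(F^{(n)}) = 0` for all large `n`.
[cite: KiKim2000, §2 Thm. 2.1] [cite: CravenCsordas2006, Thm. 3.24] -/
theorem polyaWiman_nonrealZeroCount_eq_zero {F : ℂ → ℂ} (hF : IsEntireOfOrderLt 2 F)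
    (hreal : IsRealOnReal F) (hfin : {z : ℂ | F z = 0 ∧ z.im ≠ 0}.Finite) :
    ∃ N : ℕ, ∀ n : ℕ, N ≤ n → nonrealZeroCount (iteratedDeriv n F) = 0 := by
  obtain ⟨N, hN⟩ := polyaWiman_of_isEntireOfOrderLt_two hF hreal hfin
  exact ⟨N, fun n hn ↦ (hN n hn).nonrealZeroCount_eq_zero⟩

/-- The same for members of `𝓛𝓟*` of order `< 2` (their non-real zeros are finite in number,
`IsLaguerrePolyaStar.finite_nonreal_zeros`). [cite: KiKim2000, §2 Thm. 2.1] [cite: Kim1990, Thm. 1] -/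
theorem IsLaguerrePolyaStar.polyaWiman {F : ℂ → ℂ} (hF : IsLaguerrePolyaStar F)
    (hord : IsEntireOfOrderLt 2 F) :
    ∃ N : ℕ, ∀ n : ℕ, N ≤ n → IsLaguerrePolya (iteratedDeriv n F) := by
  by_cases h0 : ∃ w, F w ≠ 0
  · exact polyaWiman_of_isEntireOfOrderLt_two hord hF.isRealOnReal (hF.finite_nonreal_zeros h0)
  · push Not at h0
    have hF0 : F = 0 := funext h0
    refine ⟨0, fun n _ ↦ ?_⟩
    rw [hF0, iteratedDeriv_zero_fun]
    exact isLaguerrePolya_zero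

end PolyaWiman

end Literature.Analysis.Complex

end
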